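import Summits.AtomisticToContinuum.Crystallization.Theorems.FrustratedLawDichotomyDoublingGap

/-!
# FrustratedLawDichotomy · crux `AperiodicFrustratedLawGap` (stmt-AtomisticToContinuum-27623) — COVARIANT THINNING OF LAWS AND THINNING STABILITY
# (decomp-a2c, prover hand 2, structural share, generation 2)

A second NON-AFFINE family of admissible competitors (after the two-copy superposition of generation 0): COVARIANT THINNINGS.  Fix a
Giry-measurable set `G` of rooted configurations and delete from a configuration `μ` every atom `y` whose rooted view `θ_y μ` is outside `G`:
`T_G μ = μ|{y : θ_y μ ∈ G}`; condition the law on the root being kept (`μ ∈ G`).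

* `exists_measurable_thinning` — there is a MEASURABLE map `T` of the Giry space agreeing with `T_G` on rooted hard-core configurations (built
  from the truncated identity kernel `κ` of the prelude: `T ν = (κ ν)|{y : θ_y(κ ν) ∈ G}`);
* `thin_reroot` — deletion commutes with re-rooting at kept atoms, `T_G(θ_y μ) = θ_y(T_G μ)`; `isRootedHardCore_thin` — hard cores survive;
* `isPointStationaryLaw_thinned` — **the thinned law `(P|G) ∘ T_G⁻¹` of a point-stationary hard-core law is point-stationary** (Mecke for
  `g̃(μ, y) = 1_G(μ) 1_G(θ_y μ) g(T_G μ, y)`: the two indicators swap under the Mecke involution and `T_G` commutes with re-rooting);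
* `thinning_stability` — **THINNING STABILITY** (granted the floor of item 9229, hypothesis `hU`): for every point-stationary `δ`-hard-core
  probability law and every measurable `G`, `P(G) · e⋆ ≤ ∫_G rootEnergy(T_G μ) dP(μ)`: no covariant deletion rule yields a law of conditional
  mean energy below `e⋆`.  For a MINIMISER (`E_P[rootEnergy] = e⋆`) this reads `E_P[1_G · rootEnergy ∘ T_G] ≥ P(G) · E_P[rootEnergy]` —
  deleting any covariantly selected family of atoms (rattlers, badly bound atoms, a sub-lattice, …) never pays.

All `[folklore]` (Palm calculus of dependent thinnings; the law-level twin of "removing atoms from a ground state does not lower E/N").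
-/

noncomputable section

namespace Summit.AtomisticToContinuum.Crystallization.Theorems.FrustratedLawDichotomyThinning

open MeasureTheory Metric Set Filter ProbabilityTheory
open scoped ENNReal Topology BigOperators
open Literature.MathematicalPhysics.StatisticalMechanics Literature.Probability.Process
open Summit.AtomisticToContinuum.Crystallization.Theorems.ChargedEnergyGapNegative (E3 eStar)
open Summit.AtomisticToContinuum.Crystallization.Theorems.BenjaminiSchrammLimit (measurableSet_setOf_isRootedHardCore)
open Summit.AtomisticToContinuum.Crystallization.Theorems.FrustratedLawDichotomyFiniteClusterGap
  (ae_mem_of_sep exists_kernel_eq_count_restrict measurable_kernel_map_sub aemeasurable_lintegral_of_ae_hardCore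
    aemeasurable_lintegral_reroot_of_ae_hardCore integrable_rootEnergy_of_ae_hardCore)

variable {δ : ℝ} {G : Set (Measure E3)}

/-! ## §1. Thinning a rooted hard-core configuration -/

section Config

/-- Restricting a rooted `δ`-hard-core configuration to a measurable set of atoms containing the root gives a rooted `δ`-hard-core configuration.
[folklore] -/
theorem isRootedHardCore_thin {μ : Measure E3} (hμ : IsRootedHardCore δ μ) {A : Set E3} (hA : MeasurableSet A) (h0 : (0 : E3) ∈ A) :
    IsRootedHardCore δ (μ.restrict A) := by
  obtain ⟨S, h0S, hsep, rfl⟩ := hμ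
  refine ⟨A ∩ S, ⟨h0, h0S⟩, fun x hx y hy hxy => hsep x hx.2 y hy.2 hxy, ?_⟩
  rw [Measure.restrict_restrict hA]

/-- Re-rooting twice: `θ_z (θ_y μ) = θ_{y + z} μ`… in the form `(μ.map (· − y)).map (· − z) = μ.map (· − (z + y))`. [folklore] -/
theorem map_sub_map_sub (μ : Measure E3) (y z : E3) :
    (μ.map fun x : E3 => x - y).map (fun x : E3 => x - z) = μ.map fun x : E3 => x - (z + y) := by
  rw [Measure.map_map (measurable_sub_const z) (measurable_sub_const y)]
  congr 1
  funext x
  simp only [Function.comp_apply]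
  abel

/-- Re-rooting back: `(μ.map (· − y)).map (· − (−y)) = μ`. [folklore] -/
theorem map_sub_map_sub_neg (μ : Measure E3) (y : E3) :
    (μ.map fun x : E3 => x - y).map (fun x : E3 => x - -y) = μ := by
  rw [map_sub_map_sub, neg_add_cancel]
  simp only [sub_zero, Measure.map_id']

/-- The kept set re-rooted: `{z | θ_z(θ_y μ) ∈ G} = (· + y) ⁻¹' {u | θ_u μ ∈ G}`. [folklore] -/
theorem keptSet_reroot (μ : Measure E3) (y : E3) :
    {z : E3 | (μ.map fun x : E3 => x - y).map (fun x : E3 => x - z) ∈ G} = (fun z : E3 => z + y) ⁻¹' {u : E3 | μ.map (fun x : E3 => x - u) ∈ G} := by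
  ext z
  simp only [Set.mem_setOf_eq, Set.mem_preimage, map_sub_map_sub]

/-- **Deletion commutes with re-rooting**: for a rooted hard-core `μ = count|S`, a measurable kept set `A = {u | θ_u μ ∈ G}` and an atom `y`,
`(θ_y μ)|{z | θ_z(θ_y μ) ∈ G} = θ_y (μ|A)`. [folklore] -/
theorem thin_reroot {μ : Measure E3} (hμ : IsRootedHardCore δ μ) (hA : MeasurableSet {u : E3 | μ.map (fun x : E3 => x - u) ∈ G}) (y : E3) :
    (μ.map fun x : E3 => x - y).restrict {z : E3 | (μ.map fun x : E3 => x - y).map (fun x : E3 => x - z) ∈ G} =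
      (μ.restrict {u : E3 | μ.map (fun x : E3 => x - u) ∈ G}).map fun x : E3 => x - y := by
  obtain ⟨S, h0S, hsep, rfl⟩ := hμ
  set A : Set E3 := {u : E3 | ((Measure.count : Measure E3).restrict S).map (fun x : E3 => x - u) ∈ G} with hAdef
  rw [keptSet_reroot, map_sub_count_restrict, Measure.restrict_restrict hA, Measure.restrict_restrict ((measurable_add_const y) hA),
    map_sub_count_restrict]
  congr 1
  ext z
  simp only [Set.mem_inter_iff, Set.mem_preimage, Set.mem_image]
  constructor
  · rintro ⟨hz, x, hx, rfl⟩
    exact ⟨x, ⟨by simpa using hz, hx⟩, rfl⟩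
  · rintro ⟨x, ⟨hxA, hxS⟩, rfl⟩
    exact ⟨by simpa using hxA, x, hxS, rfl⟩

end Config

/-! ## §2. A measurable version of the thinning map -/

section MeasurableThinning

/-- **A measurable thinning map.**  For `δ > 0` and a measurable `G` there is a measurable `T : Measure ℝ³ → Measure ℝ³` with
`T μ = μ|{u | θ_u μ ∈ G}` for every rooted `δ`-hard-core `μ`, the kept set being measurable (via the truncated identity kernel). [folklore] -/
theorem exists_measurable_thinning (hδ : 0 < δ) (hG : MeasurableSet G) :
    ∃ T : Measure E3 → Measure E3, Measurable T ∧ ∀ μ : Measure E3, IsRootedHardCore δ μ →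
      MeasurableSet {u : E3 | μ.map (fun x : E3 => x - u) ∈ G} ∧ T μ = μ.restrict {u : E3 | μ.map (fun x : E3 => x - u) ∈ G} := by
  obtain ⟨κ, hκs, hκ⟩ := exists_kernel_eq_count_restrict hδ
  -- the jointly measurable kept relation
  set A : Set (Measure E3 × E3) := (fun q : Measure E3 × E3 => (κ q.1).map fun z => z - q.2) ⁻¹' G with hAdef
  have hA : MeasurableSet A := measurable_kernel_map_sub κ hG
  refine ⟨fun ν => (κ ν).restrict (Prod.mk ν ⁻¹' A), ?_, fun μ hμ => ?_⟩
  · refine Measure.measurable_of_measurable_coe _ fun s hs => ?_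
    have heq : (fun ν : Measure E3 => (κ ν).restrict (Prod.mk ν ⁻¹' A) s) =
        fun ν => ∫⁻ x, (A ∩ (Set.univ ×ˢ s)).indicator (fun _ => (1 : ℝ≥0∞)) (ν, x) ∂(κ ν) := by
      funext ν
      rw [Measure.restrict_apply hs, ← lintegral_indicator_one (hs.inter (measurable_prodMk_left hA))]
      congr 1
      funext x
      by_cases hx : x ∈ s ∩ Prod.mk ν ⁻¹' A
      · rw [Set.indicator_of_mem hx, Pi.one_apply,
          Set.indicator_of_mem (show (ν, x) ∈ A ∩ Set.univ ×ˢ s from ⟨hx.2, Set.mem_univ _, hx.1⟩)]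
      · rw [Set.indicator_of_notMem hx, Set.indicator_of_notMem]
        rintro ⟨h1, -, h2⟩
        exact hx ⟨h2, h1⟩
    rw [heq]
    exact Measurable.lintegral_kernel_prod_right ((measurable_const.indicator (hA.inter (MeasurableSet.univ.prod hs))))
  · obtain ⟨S, h0S, hsep, rfl⟩ := hμ
    have hκμ := hκ S hsep
    have hsec : Prod.mk ((Measure.count : Measure E3).restrict S) ⁻¹' A =
        {u : E3 | ((Measure.count : Measure E3).restrict S).map (fun x : E3 => x - u) ∈ G} := by
      ext u
      simp only [hAdef, Set.mem_preimage, Set.mem_setOf_eq, hκμ]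
    refine ⟨?_, ?_⟩
    · rw [← hsec]; exact measurable_prodMk_left hA
    · simp only [hκμ, hsec]

end MeasurableThinning

/-! ## §3. The thinned law is point-stationary -/

section Stationary

variable {P : Measure (Measure E3)}

/-- The thinned law of a law almost surely carried by rooted `δ`-hard-core configurations is almost surely carried by rooted `δ`-hard-core
configurations. [folklore] -/
theorem ae_isRootedHardCore_thinned (hδ : 0 < δ) (hcore : ∀ᵐ μ ∂P, IsRootedHardCore δ μ) (hG : MeasurableSet G)
    {T : Measure E3 → Measure E3} (hTm : Measurable T)
    (hT : ∀ μ : Measure E3, IsRootedHardCore δ μ →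
      MeasurableSet {u : E3 | μ.map (fun x : E3 => x - u) ∈ G} ∧ T μ = μ.restrict {u : E3 | μ.map (fun x : E3 => x - u) ∈ G}) :
    ∀ᵐ ν ∂((P.restrict G).map T), IsRootedHardCore δ ν := by
  refine (ae_map_iff hTm.aemeasurable (measurableSet_setOf_isRootedHardCore hδ)).2 ?_
  filter_upwards [ae_restrict_of_ae (s := G) hcore, ae_restrict_mem hG] with μ hμ hμG
  obtain ⟨hA, hTμ⟩ := hT μ hμ
  rw [hTμ]
  refine isRootedHardCore_thin hμ hA ?_
  show μ.map (fun x : E3 => x - 0) ∈ G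
  simpa using hμG

/-- **THE THINNED LAW IS POINT-STATIONARY.**  Let `P` be point-stationary and almost surely carried by rooted `δ`-hard-core configurations,
`G` measurable, `T` a measurable thinning map (`exists_measurable_thinning`).  Then `(P|G) ∘ T⁻¹` is point-stationary: the Mecke identity
of `P` for `g̃(μ, y) = 1_G(μ)·1_G(θ_y μ)·g(T μ, y)` is the Mecke identity of the thinned law for `g`, because the involution
`(μ, y) ↦ (θ_y μ, −y)` swaps the two indicators and `T(θ_y μ) = θ_y(T μ)`. [folklore] -/
theorem isPointStationaryLaw_thinned (hδ : 0 < δ) (hcore : ∀ᵐ μ ∂P, IsRootedHardCore δ μ) (hstat : IsPointStationaryLaw P)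
    (hG : MeasurableSet G) {T : Measure E3 → Measure E3} (hTm : Measurable T)
    (hT : ∀ μ : Measure E3, IsRootedHardCore δ μ →
      MeasurableSet {u : E3 | μ.map (fun x : E3 => x - u) ∈ G} ∧ T μ = μ.restrict {u : E3 | μ.map (fun x : E3 => x - u) ∈ G}) :
    IsPointStationaryLaw ((P.restrict G).map T) := by
  classical
  intro g hg
  have hcoreQ := ae_isRootedHardCore_thinned hδ hcore hG hTm hT
  -- both sides of the Mecke identity of the thinned law, pulled back to `P|G`
  rw [lintegral_map' (aemeasurable_lintegral_of_ae_hardCore hδ hcoreQ hg) hTm.aemeasurable,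
    lintegral_map' (aemeasurable_lintegral_reroot_of_ae_hardCore hδ hcoreQ hg) hTm.aemeasurable]
  -- a jointly measurable version of the kept relation (truncated identity kernel)
  obtain ⟨κ, hκs, hκ⟩ := exists_kernel_eq_count_restrict hδ
  have hκid : ∀ μ : Measure E3, IsRootedHardCore δ μ → κ μ = μ := by
    rintro μ ⟨S, -, hsep, rfl⟩; exact hκ S hsep
  set A : Set (Measure E3 × E3) := (fun q : Measure E3 × E3 => (κ q.1).map fun z => z - q.2) ⁻¹' G with hAdef
  have hA : MeasurableSet A := measurable_kernel_map_sub κ hG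
  have hsec : ∀ μ : Measure E3, IsRootedHardCore δ μ → ∀ y : E3,
      ((μ, y) ∈ A ↔ y ∈ {u : E3 | μ.map (fun x : E3 => x - u) ∈ G}) := fun μ hμ y => by
    simp only [hAdef, Set.mem_preimage, Set.mem_setOf_eq, hκid μ hμ]
  -- the transported test function
  set g' : Measure E3 → E3 → ℝ≥0∞ := fun μ y =>
    G.indicator (fun _ => (1 : ℝ≥0∞)) μ * (A.indicator (fun _ => (1 : ℝ≥0∞)) (μ, y) * g (T μ) y) with hg'
  have hg'm : Measurable (Function.uncurry g') :=
    ((measurable_const.indicator hG).comp measurable_fst).mul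
      ((measurable_const.indicator hA).mul (hg.comp ((hTm.comp measurable_fst).prodMk measurable_snd)))
  have key := hstat g' hg'm
  -- left side of `key` on hard-core configurations
  have hL : ∫⁻ μ, ∫⁻ y, g' μ y ∂μ ∂P = ∫⁻ μ in G, ∫⁻ y, g (T μ) y ∂(T μ) ∂P := by
    rw [← lintegral_indicator hG]
    refine lintegral_congr_ae (hcore.mono fun μ hμ => ?_)
    dsimp only
    obtain ⟨hAμ, hTμ⟩ := hT μ hμ
    by_cases hμG : μ ∈ G
    · rw [Set.indicator_of_mem hμG, hTμ, ← lintegral_indicator hAμ]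
      refine lintegral_congr fun y => ?_
      simp only [hg', Set.indicator_of_mem hμG, one_mul, hTμ]
      by_cases hy : y ∈ {u : E3 | μ.map (fun x : E3 => x - u) ∈ G}
      · rw [Set.indicator_of_mem hy, Set.indicator_of_mem ((hsec μ hμ y).2 hy), one_mul]
      · rw [Set.indicator_of_notMem hy, Set.indicator_of_notMem (fun h => hy ((hsec μ hμ y).1 h)), zero_mul]
    · rw [Set.indicator_of_notMem hμG]
      refine (lintegral_congr fun y => ?_).trans lintegral_zero
      simp only [hg', Set.indicator_of_notMem hμG, zero_mul]
  -- right side of `key` on hard-core configurations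
  have hR : ∫⁻ μ, ∫⁻ y, g' (μ.map fun x : E3 => x - y) (-y) ∂μ ∂P =
      ∫⁻ μ in G, ∫⁻ y, g ((T μ).map fun x : E3 => x - y) (-y) ∂(T μ) ∂P := by
    rw [← lintegral_indicator hG]
    refine lintegral_congr_ae (hcore.mono fun μ hμ => ?_)
    dsimp only
    obtain ⟨hAμ, hTμ⟩ := hT μ hμ
    have hμ' := hμ
    obtain ⟨S, h0S, hsep, rfl⟩ := hμ
    -- pointwise identity at the atoms
    have hpt : ∀ y ∈ S, g' (((Measure.count : Measure E3).restrict S).map fun x : E3 => x - y) (-y) =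
        G.indicator (fun _ => (1 : ℝ≥0∞)) ((Measure.count : Measure E3).restrict S) *
          ({u : E3 | ((Measure.count : Measure E3).restrict S).map (fun x : E3 => x - u) ∈ G}.indicator
            (fun y => g ((T ((Measure.count : Measure E3).restrict S)).map fun x : E3 => x - y) (-y)) y) := by
      intro y hy
      have hy' : (Measure.count : Measure E3).restrict S {y} ≠ 0 := (count_restrict_singleton_ne_zero_iff S y).2 hy
      have hθ : IsRootedHardCore δ (((Measure.count : Measure E3).restrict S).map fun x : E3 => x - y) := hμ'.map_sub hy'
      obtain ⟨hAθ, hTθ⟩ := hT _ hθ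
      -- the three factors
      have h1 : G.indicator (fun _ => (1 : ℝ≥0∞)) (((Measure.count : Measure E3).restrict S).map fun x : E3 => x - y) =
          {u : E3 | ((Measure.count : Measure E3).restrict S).map (fun x : E3 => x - u) ∈ G}.indicator (fun _ => (1 : ℝ≥0∞)) y := by
        by_cases h : ((Measure.count : Measure E3).restrict S).map (fun x : E3 => x - y) ∈ G
        · have hyA : y ∈ {u : E3 | ((Measure.count : Measure E3).restrict S).map (fun x : E3 => x - u) ∈ G} := h
          rw [Set.indicator_of_mem h, Set.indicator_of_mem hyA]
        · have hyA : y ∉ {u : E3 | ((Measure.count : Measure E3).restrict S).map (fun x : E3 => x - u) ∈ G} := h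
          rw [Set.indicator_of_notMem h, Set.indicator_of_notMem hyA]
      have h2 : A.indicator (fun _ => (1 : ℝ≥0∞)) ((((Measure.count : Measure E3).restrict S).map fun x : E3 => x - y), -y) =
          G.indicator (fun _ => (1 : ℝ≥0∞)) ((Measure.count : Measure E3).restrict S) := by
        have hmem : ((((Measure.count : Measure E3).restrict S).map fun x : E3 => x - y), -y) ∈ A ↔
            (Measure.count : Measure E3).restrict S ∈ G := by
          rw [hsec _ hθ (-y), Set.mem_setOf_eq, map_sub_map_sub_neg]
        by_cases h : (Measure.count : Measure E3).restrict S ∈ G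
        · rw [Set.indicator_of_mem h, Set.indicator_of_mem (hmem.2 h)]
        · rw [Set.indicator_of_notMem h, Set.indicator_of_notMem (fun h' => h (hmem.1 h'))]
      have h3 : T (((Measure.count : Measure E3).restrict S).map fun x : E3 => x - y) =
          (T ((Measure.count : Measure E3).restrict S)).map fun x : E3 => x - y := by
        rw [hTθ, hTμ, thin_reroot hμ' hAμ y]
      simp only [hg']
      rw [h1, h2, h3]
      by_cases hy2 : y ∈ {u : E3 | ((Measure.count : Measure E3).restrict S).map (fun x : E3 => x - u) ∈ G}
      · simp only [Set.indicator_of_mem hy2, one_mul, mul_comm]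
      · simp only [Set.indicator_of_notMem hy2, zero_mul, mul_zero]
    rw [lintegral_congr_ae ((ae_mem_of_sep hδ hsep).mono hpt)]
    by_cases hμG : (Measure.count : Measure E3).restrict S ∈ G
    · rw [Set.indicator_of_mem hμG, lintegral_const_mul' _ _ ENNReal.one_ne_top, one_mul, lintegral_indicator hAμ, ← hTμ,
        Set.indicator_of_mem hμG]
    · rw [Set.indicator_of_notMem hμG, lintegral_const_mul' _ _ ENNReal.zero_ne_top, zero_mul, Set.indicator_of_notMem hμG]
  exact hL.symm.trans (key.trans hR)

end Stationary

/-! ## §4. Thinning stability -/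

section Stability

variable {P : Measure (Measure E3)}

/-- **THINNING STABILITY.**  Granted the energy floor for point-stationary hard-core probability laws (item 9229, hypothesis `hU`): for every
point-stationary `δ`-hard-core probability law `P` and every Giry-measurable `G` (delete the atoms `y` with `θ_y μ ∉ G`, keep the root iff
`μ ∈ G`), `P(G) · e⋆ ≤ ∫_G rootEnergy(μ|{u | θ_u μ ∈ G}) dP(μ)` — the thinned, re-normalised law is an admissible competitor.  For a
minimiser: `E_P[1_G · rootEnergy(T_G μ)] ≥ P(G) · E_P[rootEnergy]`. [folklore] -/
theorem thinning_stability
    (hU : ∀ δ' : ℝ, 0 < δ' → ∀ Q : Measure (Measure E3), IsProbabilityMeasure Q → (∀ᵐ μ ∂Q, IsRootedHardCore δ' μ) →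
      IsPointStationaryLaw Q → eStar ≤ ∫ μ, rootEnergy lennardJones μ ∂Q)
    (hδ : 0 < δ) [IsProbabilityMeasure P] (hcore : ∀ᵐ μ ∂P, IsRootedHardCore δ μ) (hstat : IsPointStationaryLaw P)
    (hG : MeasurableSet G) :
    (P G).toReal * eStar ≤ ∫ μ in G, rootEnergy lennardJones (μ.restrict {u : E3 | μ.map (fun x : E3 => x - u) ∈ G}) ∂P := by
  obtain ⟨T, hTm, hT⟩ := exists_measurable_thinning (G := G) hδ hG
  by_cases hG0 : P G = 0
  · rw [hG0, ENNReal.toReal_zero, zero_mul, Measure.restrict_eq_zero.2 hG0, integral_zero_measure]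
  set Q : Measure (Measure E3) := (P.restrict G).map T with hQ
  have hQuniv : Q univ = P G := by
    rw [hQ, Measure.map_apply hTm MeasurableSet.univ, Set.preimage_univ, Measure.restrict_apply_univ]
  have hQ' : IsProbabilityMeasure ((P G)⁻¹ • Q) :=
    ⟨by rw [Measure.smul_apply, hQuniv, smul_eq_mul, ENNReal.inv_mul_cancel hG0 (measure_ne_top P G)]⟩
  have hcoreQ : ∀ᵐ ν ∂Q, IsRootedHardCore δ ν := ae_isRootedHardCore_thinned hδ hcore hG hTm hT
  have hstatQ : IsPointStationaryLaw Q := isPointStationaryLaw_thinned hδ hcore hstat hG hTm hT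
  have hfloor := hU δ hδ ((P G)⁻¹ • Q) hQ' (Measure.ae_smul_measure hcoreQ _) (hstatQ.smul _)
  rw [integral_smul_measure, ENNReal.toReal_inv, smul_eq_mul] at hfloor
  haveI : IsFiniteMeasure Q := ⟨by rw [hQuniv]; exact measure_lt_top P G⟩
  have hint : Integrable (fun ν => rootEnergy lennardJones ν) Q := integrable_rootEnergy_of_ae_hardCore hδ hcoreQ
  have hmap : ∫ ν, rootEnergy lennardJones ν ∂Q = ∫ μ in G, rootEnergy lennardJones (T μ) ∂P := by
    rw [hQ, integral_map hTm.aemeasurable]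
    rw [← hQ]; exact hint.aestronglyMeasurable
  have hcongr : ∫ μ in G, rootEnergy lennardJones (T μ) ∂P =
      ∫ μ in G, rootEnergy lennardJones (μ.restrict {u : E3 | μ.map (fun x : E3 => x - u) ∈ G}) ∂P :=
    integral_congr_ae ((ae_restrict_of_ae (s := G) hcore).mono fun μ hμ => by
      show rootEnergy lennardJones (T μ) = _
      rw [(hT μ hμ).2])
  rw [hmap, hcongr] at hfloor
  have hpos : 0 < (P G).toReal := ENNReal.toReal_pos hG0 (measure_ne_top P G)
  calc (P G).toReal * eStar
      ≤ (P G).toReal * ((P G).toReal⁻¹ *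
          ∫ μ in G, rootEnergy lennardJones (μ.restrict {u : E3 | μ.map (fun x : E3 => x - u) ∈ G}) ∂P) :=
        mul_le_mul_of_nonneg_left hfloor hpos.le
    _ = ∫ μ in G, rootEnergy lennardJones (μ.restrict {u : E3 | μ.map (fun x : E3 => x - u) ∈ G}) ∂P := by
        rw [← mul_assoc, mul_inv_cancel₀ hpos.ne', one_mul]

end Stability

end Summit.AtomisticToContinuum.Crystallization.Theorems.FrustratedLawDichotomyThinning

end
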